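import Mathlib
import HarnessLib

/-!
# The chain rule for counting a set of permutations along an order of the rows

Let `X` be a finite set of permutations of `Fin n` and `σ ∈ X`.  For a set of rows `B ⊆ Fin n` write
`F_B(σ) = {σ' ∈ X : σ' i' = σ i' for all i' ∈ B}` for the fibre of `σ` over `B` (the members of `X`
that agree with `σ` on the rows in `B`).  An *order* of the rows is a permutation `τ` of `Fin n`, read
as "row `τ k` is revealed at step `k`"; the rows revealed before row `i` are
`B(τ, i) = {i' : τ⁻¹ i' < τ⁻¹ i}`.  Revealing the rows of `σ` one at a time in the order `τ`, the
count `#X` telescopes through the fibres (`log_card_eq_sum_log_card_fibre_sub`):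

  `log #X = ∑_i (log #F_{B(τ,i)}(σ) - log #F_{B(τ,i) ∪ {i}}(σ))`,

because `F_∅(σ) = X`, `F_univ(σ) = {σ}` and `B(τ, τ k) ∪ {τ k} = B(τ, τ (k+1))` is the set of the
first `k + 1` rows in the order `τ`.  Summed over all `n !` orders `τ` and all `σ ∈ X` this is the
purely combinatorial half of Radhakrishnan's random-order entropy proof of Brégman's theorem
[Radhakrishnan1997, proof of Thm 1] (and of the Cuckler–Kahn entropy bound [CucklerKahn2009]):

  `n ! · #X · log #X = ∑_i ∑_τ ∑_{σ ∈ X} (log #F_{B(τ,i)}(σ) - log #F_{B(τ,i) ∪ {i}}(σ))`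

(`factorial_mul_card_mul_log_card_eq_sum_chain`).  In entropy language: for `σ` uniform on `X`,
`H(σ) = ∑_i H(σ_i | σ_{B(τ,i)})` for every order `τ`, averaged over `τ`.  Throughout, the fibre over
`B(τ,i) ∪ {i}` is written with the extra conjunct `σ' i = σ i` rather than with a union.

Design: no definitions are introduced (the fibres are spelled out as `Finset.filter`s, exactly as the
consumer in `Summits/MatrixMultiplication` states them); the prefix fibres used in the proof are
indexed by `k : ℕ` ("the rows `i'` with `τ⁻¹ i' < k`") so that `k = n` is allowed.  Deliberately not
here: the entropy inequality itself (Gibbs / Jensen steps) and Shearer-type generalisations.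

References: J. Radhakrishnan, An entropy proof of Bregman's theorem, *J. Combin. Theory Ser. A* 77
(1997) 161–164 [Radhakrishnan1997]; B. Cuckler, J. Kahn, Entropy bounds for perfect matchings and
Hamiltonian cycles, *Combinatorica* 29 (2009) 327–335 [CucklerKahn2009].
-/

namespace Literature.Combinatorics.Enumerative

open Finset

section ChainRule

variable {n : ℕ} (X : Finset (Equiv.Perm (Fin n))) (τ σ : Equiv.Perm (Fin n))

/-- The prefix fibre over the first `0` rows of an order is all of `X`. [folklore] -/
theorem filter_forall_val_symm_lt_zero :
    X.filter (fun σ' => ∀ i', (τ.symm i' : ℕ) < 0 → σ' i' = σ i') = X :=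
  Finset.filter_true_of_mem fun _ _ _ hi' => absurd hi' (Nat.not_lt_zero _)

/-- The prefix fibre over the first `n` rows of an order (i.e. over all rows) is `{σ}` when
`σ ∈ X`: a permutation agreeing with `σ` in every row is `σ`. [folklore] -/
theorem filter_forall_val_symm_lt_eq_singleton (hσ : σ ∈ X) :
    X.filter (fun σ' => ∀ i', (τ.symm i' : ℕ) < n → σ' i' = σ i') = {σ} := by
  ext σ'
  simp only [Finset.mem_filter, Finset.mem_singleton]
  constructor
  · rintro ⟨-, h⟩
    exact Equiv.ext fun i' => h i' (τ.symm i').isLt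
  · rintro rfl
    exact ⟨hσ, fun _ _ => rfl⟩

/-- The fibre over the rows revealed before row `τ k` is the prefix fibre over the first `k` rows:
`B(τ, τ k) = {i' : τ⁻¹ i' < k}`. [folklore] -/
theorem filter_forall_mem_filter_symm_lt_apply (k : Fin n) :
    X.filter (fun σ' => ∀ i' ∈ Finset.univ.filter (fun i' => τ.symm i' < τ.symm (τ k)),
        σ' i' = σ i') =
      X.filter (fun σ' => ∀ i', (τ.symm i' : ℕ) < k → σ' i' = σ i') := by
  refine Finset.filter_congr fun σ' _ => ?_
  simp only [Finset.mem_filter, Finset.mem_univ, true_and, Equiv.symm_apply_apply, Fin.lt_def]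

/-- Revealing row `τ k` after the rows revealed before it gives the prefix fibre over the first
`k + 1` rows: `B(τ, τ k) ∪ {τ k} = {i' : τ⁻¹ i' < k + 1}`. [folklore] -/
theorem filter_forall_mem_filter_symm_lt_apply_and (k : Fin n) :
    X.filter (fun σ' => (∀ i' ∈ Finset.univ.filter (fun i' => τ.symm i' < τ.symm (τ k)),
        σ' i' = σ i') ∧ σ' (τ k) = σ (τ k)) =
      X.filter (fun σ' => ∀ i', (τ.symm i' : ℕ) < k + 1 → σ' i' = σ i') := by
  refine Finset.filter_congr fun σ' _ => ?_
  simp only [Finset.mem_filter, Finset.mem_univ, true_and, Equiv.symm_apply_apply, Fin.lt_def]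
  constructor
  · rintro ⟨h, hk⟩ i' hi'
    rcases Nat.lt_succ_iff_lt_or_eq.mp hi' with hlt | heq
    · exact h i' hlt
    · obtain rfl : τ.symm i' = k := Fin.ext heq
      simpa using hk
  · intro h
    exact ⟨fun i' hi' => h i' (Nat.lt_succ_of_lt hi'), h (τ k) (by simp)⟩

/-- **Chain rule along one order (telescoping).**  For `σ ∈ X` and any order `τ` of the rows,
`log #X = ∑_i (log #F_{B(τ,i)}(σ) - log #F_{B(τ,i) ∪ {i}}(σ))`, where
`F_B(σ) = {σ' ∈ X : σ' = σ on B}` and `B(τ,i) = {i' : τ⁻¹ i' < τ⁻¹ i}` is the set of rows revealed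
before `i`: reindexing `i = τ k`, the `k`-th term is `log #F_{first k rows} - log #F_{first k+1 rows}`,
and the sum telescopes from `log #X` (`k = 0`) to `log #{σ} = 0` (`k = n`). [folklore] -/
theorem log_card_eq_sum_log_card_fibre_sub (hσ : σ ∈ X) :
    Real.log (X.card : ℝ) = ∑ i : Fin n,
      (Real.log ((X.filter (fun σ' => ∀ i' ∈ Finset.univ.filter (fun i' => τ.symm i' < τ.symm i),
          σ' i' = σ i')).card : ℝ) -
        Real.log ((X.filter (fun σ' => (∀ i' ∈ Finset.univ.filter
          (fun i' => τ.symm i' < τ.symm i), σ' i' = σ i') ∧ σ' i = σ i)).card : ℝ)) := by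
  -- `a k` = log of the size of the prefix fibre over the first `k` rows in the order `τ`
  set a : ℕ → ℝ := fun k =>
    Real.log ((X.filter (fun σ' => ∀ i', (τ.symm i' : ℕ) < k → σ' i' = σ i')).card : ℝ) with ha
  have h0 : a 0 = Real.log (X.card : ℝ) := by
    simp only [ha, filter_forall_val_symm_lt_zero]
  have hn : a n = 0 := by
    simp only [ha, filter_forall_val_symm_lt_eq_singleton X τ σ hσ, Finset.card_singleton,
      Nat.cast_one, Real.log_one]
  calc Real.log (X.card : ℝ) = a 0 - a n := by rw [h0, hn, sub_zero]
    _ = ∑ k ∈ Finset.range n, (a k - a (k + 1)) := (Finset.sum_range_sub' a n).symm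
    _ = ∑ k : Fin n, (a k - a (k + 1)) := (Fin.sum_univ_eq_sum_range (fun k => a k - a (k + 1)) n).symm
    _ = ∑ k : Fin n,
          (Real.log ((X.filter (fun σ' => ∀ i' ∈ Finset.univ.filter
              (fun i' => τ.symm i' < τ.symm (τ k)), σ' i' = σ i')).card : ℝ) -
            Real.log ((X.filter (fun σ' => (∀ i' ∈ Finset.univ.filter
              (fun i' => τ.symm i' < τ.symm (τ k)), σ' i' = σ i') ∧
                σ' (τ k) = σ (τ k))).card : ℝ)) := by
        refine Finset.sum_congr rfl fun k _ => ?_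
        rw [filter_forall_mem_filter_symm_lt_apply, filter_forall_mem_filter_symm_lt_apply_and]
    _ = _ := Equiv.sum_comp τ (fun i =>
          Real.log ((X.filter (fun σ' => ∀ i' ∈ Finset.univ.filter
              (fun i' => τ.symm i' < τ.symm i), σ' i' = σ i')).card : ℝ) -
            Real.log ((X.filter (fun σ' => (∀ i' ∈ Finset.univ.filter
              (fun i' => τ.symm i' < τ.symm i), σ' i' = σ i') ∧ σ' i = σ i)).card : ℝ))

end ChainRule

/-- **Chain rule summed over all orders** (the counting half of Radhakrishnan's random-order entropy
proof of Brégman's theorem).  For a finite set `X` of permutations of `Fin n`, with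
`F_B(σ) = {σ' ∈ X : σ' = σ on B}` and `B(τ,i) = {i' : τ⁻¹ i' < τ⁻¹ i}` (rows revealed before `i` in
the order `τ`):

  `n ! · #X · log #X = ∑_i ∑_τ ∑_{σ ∈ X} (log #F_{B(τ,i)}(σ) - log #F_{B(τ,i) ∪ {i}}(σ))`,

i.e. `log #X = ∑_i E_τ E_σ [log #F_{B(τ,i)}(σ) - log #F_{B(τ,i) ∪ {i}}(σ)]` for `τ` uniform among
the `n !` orders and `σ` uniform on `X` (for `X = ∅` both sides vanish).  Proof: exchange the sums
and telescope along each order (`log_card_eq_sum_log_card_fibre_sub`).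
[cite: Radhakrishnan1997, proof of Thm 1] -/
theorem factorial_mul_card_mul_log_card_eq_sum_chain {n : ℕ} (X : Finset (Equiv.Perm (Fin n))) :
    ((n.factorial : ℝ) * (X.card : ℝ)) * Real.log (X.card : ℝ) =
      ∑ i : Fin n, ∑ τ : Equiv.Perm (Fin n), ∑ σ ∈ X,
        (Real.log ((X.filter (fun σ' => ∀ i' ∈ Finset.univ.filter
            (fun i' => τ.symm i' < τ.symm i), σ' i' = σ i')).card : ℝ) -
          Real.log ((X.filter (fun σ' => (∀ i' ∈ Finset.univ.filter
            (fun i' => τ.symm i' < τ.symm i), σ' i' = σ i') ∧ σ' i = σ i)).card : ℝ)) := by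
  rw [Finset.sum_comm]
  have hτ : ∀ τ : Equiv.Perm (Fin n),
      ∑ i : Fin n, ∑ σ ∈ X,
        (Real.log ((X.filter (fun σ' => ∀ i' ∈ Finset.univ.filter
            (fun i' => τ.symm i' < τ.symm i), σ' i' = σ i')).card : ℝ) -
          Real.log ((X.filter (fun σ' => (∀ i' ∈ Finset.univ.filter
            (fun i' => τ.symm i' < τ.symm i), σ' i' = σ i') ∧ σ' i = σ i)).card : ℝ)) =
      ∑ σ ∈ X, Real.log (X.card : ℝ) := by
    intro τ
    rw [Finset.sum_comm]
    exact Finset.sum_congr rfl fun σ hσ => (log_card_eq_sum_log_card_fibre_sub X τ σ hσ).symm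
  rw [Finset.sum_congr rfl fun τ _ => hτ τ, Finset.sum_const, Finset.sum_const, Finset.card_univ,
    Fintype.card_perm, Fintype.card_fin, nsmul_eq_mul, nsmul_eq_mul, mul_assoc]

end Literature.Combinatorics.Enumerative
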